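import Literature.NumberTheory.EllipticCurves.DeligneSerreRankinProp55EightProofs
import Literature.NumberTheory.EllipticCurves.DeligneSerreProp27EigenvaluesProofs
import Literature.NumberTheory.EllipticCurves.ManinSymbolsWeightKGamma1RankProofs
import HarnessLib

/-!
# Deligne–Serre 1974, Prop. 5.5 — the discharge `prop55_holds`

A proofs-only leaf (one theorem; no definition, no named fact; D-0026) discharging the named fact
`Literature.NumberTheory.EllipticCurves.ModularForms.DeligneSerre1974.prop55`
(`Literature.NumberTheory.EllipticCurves.DeligneSerreRankin`; Deligne–Serre, *Formes modulaires de
poids 1*, Ann. Sci. ÉNS 7 (1974), Prop. 5.5, pp. 519–520): for a non-zero cusp form `f` of type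
`(1, ε)` on `Γ₀(N)`, eigen for the `T_p`, `p ∤ N`, with eigenvalues `a_p`, and every `η > 0`, there
are a set of primes `X_η` of upper density `≤ η` and a finite `Y_η ⊂ ℂ` with `a_p ∈ Y_η` for all
`p ∉ X_η`, `p ∤ N`.

The proof assembled in the tree follows the printed one (p. 520) and its inputs:

* **Prop. 5.1** (Rankin's estimate `∑_{p∤N} |a_p|² p^{-s} ≤ log(1/(s-1)) + O(1)`):
  `prop51_holds` (`DeligneSerreRankinProp51Proofs`, a Parseval substitute for Rankin–Selberg);
* **Prop. 2.7 (2.7.3), (2.7.4)** at the level and weight of the form, from **(2.7.2)** — the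
  integral lattice `L ⊆ S_1(Γ₁(N'))` spans — (`DeligneSerreRankinProp55LevelProofs`,
  `exists_numberField_of_span_integralLattice1`, `exists_conj_eigenform_of_span_integralLattice1`),
  and the p. 520 argument (`prop55_at_of_span_integralLattice1_one`);
* (2.7.2) in weight one is needed only at the levels `N' = 8N` (level raising `f ↦ [α₁] f`,
  `prop55_of_span_integralLattice1_one_of_eight_dvd`, `DeligneSerreRankinProp55EightProofs`), where
  it descends from weight `8` by division by the weight-one `η`-quotients `θ²`, `θ(2τ)²` and by
  `E₄`, `E₆` (Deligne–Serre Rem. 2.8; `DeligneSerre1974_span_integralLattice1.of_le_of_eight_dvd`,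
  `DeligneSerreProp27WeightOneDescentProofs`);
* (2.7.2) in weight `8` at a level `M ≥ 4` comes from a full Hecke-stable real lattice in
  `S₈(Γ₁(M))^∨` (Shimura 1971, (3.5.20) and Thm. 3.52: `DeligneSerreSpanHeckeDualityProofs`,
  `DeligneSerreProp27RealLatticeProofs`), namely the Eichler–Shimura period lattice
  `Λ₆ = periodLatticeK1 6`: it spans the dual over `ℝ` (`periodLatticeK1_span_real_eq_top`,
  `EichlerShimuraPeriodsGamma1RealSpanProofs`, twisted `L`-values) and has rank
  `≤ 2 dim_ℂ S₈(Γ₁(M))` — the weight-`8` Manin symbols of `Γ₁(M)` with their boundary and the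
  Manin–Drinfeld step above `∞` (`ManinK.twelve_mul_finrank_add_card_le`,
  `ManinSymbolsWeightK*`; Shimura Thm. 8.4, Merel 1994 §1.2–1.4) against the dimension lower bound
  `7·[SL₂(ℤ):±Γ₁(M)] - 6ε_∞ ≤ 12 dim S₈(Γ₁(M))` by the free-module route
  (`ModularFormsGamma1Dimension`; `periodLatticeK1_eq_span_of_rank_add_card_le`,
  `ManinK.finrank_span_range_tind`, `DeligneSerreProp27EigenvaluesProofs`);
* the levels `N ≤ 4` carry no weight-one cusp form (`cuspForm_gamma1_weight_one_eq_zero_of_le_four`),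
  and are anyway covered by the level raising.

## References

* P. Deligne, J.-P. Serre, *Formes modulaires de poids 1*, Ann. Sci. ÉNS (4) 7 (1974), 507–530:
  Prop. 2.7 and Rem. 2.8 (p. 512), Prop. 5.1 (p. 518), (5.4.1), Prop. 5.5 (pp. 519–520).
  [DeligneSerreASENS1974]
* G. Shimura, *Introduction to the arithmetic theory of automorphic functions*, Publ. Math. Soc.
  Japan 11 (1971): (3.5.20), Thm. 3.52, Thm. 8.4.
* L. Merel, *Universal Fourier expansions of modular forms*, LNM 1585 (1994), §1.2–1.4.
-/

noncomputable section

open scoped MatrixGroups ModularForm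

open CongruenceSubgroup Module

namespace Literature.NumberTheory.EllipticCurves.ModularForms.DeligneSerre1974

/-- **Deligne–Serre 1974, Prop. 5.5** (the named fact `prop55`, discharged).  Keep the hypotheses of
Prop. 5.1 — `f` a non-zero cusp form of type `(k, ε)` on `Γ₀(N)`, an eigenfunction of the `T_p`,
`p ∤ N`, with eigenvalues `a_p` — and suppose `k = 1`.  Then for every `η > 0` there are a set of
primes `X_η` with `dens.sup X_η ≤ η` and a finite subset `Y_η ⊂ ℂ` such that `a_p ∈ Y_η` for every
prime `p ∉ X_η`, `p ∤ N`.  Proof: `prop55_of_periodLatticeK1_eq_span_of_eight_dvd` in the weight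
`n + 2 = 8` with the rank count `ManinK.twelve_mul_finrank_add_card_le` (Manin symbols with cusps,
`±Γ₁(M)`, `M ≥ 8`), `ManinK.finrank_span_range_tind` and
`periodLatticeK1_eq_span_of_rank_add_card_le` (the dimension lower bound for `S₈(Γ₁(M))`).
[cite: DeligneSerreASENS1974, Prop. 5.5 (pp. 519–520)] -/
theorem prop55_holds : prop55 :=
  prop55_of_periodLatticeK1_eq_span_of_eight_dvd 6 (by norm_num) fun M _ h8 ↦ by
    have hM : 4 ≤ M := by
      have := Nat.le_of_dvd (Nat.pos_of_ne_zero (NeZero.ne M)) h8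
      omega
    have h := ManinK.twelve_mul_finrank_add_card_le M (gamma1_le_gamma1pm M) (by decide : Even 6)
      (by norm_num) (neg_one_mem_gamma1pm M) hM
    rw [ManinK.finrank_span_range_tind] at h
    exact periodLatticeK1_eq_span_of_rank_add_card_le M 6 hM (by decide) h

end Literature.NumberTheory.EllipticCurves.ModularForms.DeligneSerre1974
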